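import Mathlib.Algebra.BigOperators.Pi
import Mathlib.Algebra.GroupWithZero.Action.Basic
import Mathlib.Algebra.GroupWithZero.Action.Pointwise.Set
import Mathlib.Algebra.Order.Field.Pointwise
import Mathlib.Analysis.Calculus.FDeriv.Linear
import Mathlib.LinearAlgebra.Determinant
import Mathlib.Topology.Algebra.Module.Determinant
import Literature.NumberTheory.Transcendental.KZSemialgebraicComplex
import Literature.NumberTheory.Transcendental.KZDirichletScaling

/-!
# `NormalFormPrinciple` (stmt-KontsevichZagierPeriods-3869) — registered sub-goal
# `dlogA_scale_mem_relations` through the Mathlib API: linear changes of variables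

Siege attempt k1 ("Mathlib API route") on the registered sub-goal `dlogA_scale_mem_relations` of
crux `Summit.KontsevichZagierPeriods.KontsevichZagierPeriods.Theses.HurwitzMicroSectors.NormalFormPrinciple`
(line `SketchIdeator1`, leaf `stub_boxRigidity`, dimension one, algebraic-pole layer): for real
algebraic `s > 0` and `0 < a`, the dlog representations `[(a,b), c/y]` and `[(sa,sb), c/y]` differ
by ONE change-of-variables move (Kontsevich–Zagier rule (2)) along the dilation `s • id` of `ℝ¹`
(Jacobian `s`, `c/y = (c/(s y))·s`).

The move is obtained as the `n = 1`, `A = s • id` instance of a general **linear rule-(2)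
certificate**, stated for Mathlib's continuous linear maps:

* `isSemialgebraicMapOn_continuousLinearMap` — an `ℝ`-linear map `A : ℝᵐ → ℝⁿ` whose matrix
  entries `A (Pi.single j 1) i` are real algebraic is a `ℚ`-semialgebraic map on every
  `ℚ`-semialgebraic set (coordinates `∑ⱼ A(eⱼ)ᵢ · yⱼ`, by `pi_eq_sum_univ'`, `map_sum`, `map_smul`,
  and the toolkit `KZ.isSemialgebraicFunOn_finset_sum`, `IsSemialgebraicFunOn.mul_holds`,
  `isSemialgebraicFunOn_const_of_isAlgebraic`);
* `of_sub_of_mem_changeOfVariablesRel_continuousLinearMap` — for such an `A : ℝⁿ → ℝⁿ`, injective,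
  with `r'.domain = A '' r.domain` and `r.integrand x = r'.integrand (A x) · |det A|`, the difference
  `[r] − [r']` is one generator of `KZ.changeOfVariablesRel` (`Φ = A`, `Φ' ≡ A`,
  `ContinuousLinearMap.hasFDerivAt`);
* `smul_setOf_apply_mem` — dilating a coordinate condition: `s • {x | x i ∈ S} = {x | x i ∈ s • S}`
  (`Set.mem_smul_set_iff_inv_smul_mem₀`), combined with Mathlib's `LinearOrderedField.smul_Ioo`
  and `KZ.det_smul_id_fin` for the slab and the Jacobian.

Imports: Mathlib and `Literature` only (no `Summits` file); no definition is introduced.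

Sources: M. Kontsevich, D. Zagier, *Periods* (2001), §1.2, rule (2); J. Bochnak, M. Coste,
M.-F. Roy, *Real Algebraic Geometry* (1998), Prop. 2.2.6.
-/

noncomputable section

open Set
open scoped Pointwise
open Literature.NumberTheory.Transcendental Literature.NumberTheory.Transcendental.KZ
open Literature.ModelTheory.ExponentialFields (IsSemialgebraic)

namespace Summit.KontsevichZagierPeriods.HurwitzMicroSectors.NormalFormPrinciple.DlogAScaleMathlibK1

/-! ## Linear maps with real algebraic matrix are `ℚ`-semialgebraic -/

/-- The `i`-th coordinate of a linear map `A : ℝᵐ → ℝⁿ` is the linear form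
`y ↦ ∑ⱼ A(eⱼ)ᵢ · yⱼ` (expansion along the standard basis `eⱼ = Pi.single j 1`). [folklore] -/
theorem continuousLinearMap_apply_eq_sum {m n : ℕ} (A : (Fin m → ℝ) →L[ℝ] (Fin n → ℝ))
    (y : Fin m → ℝ) (i : Fin n) : A y i = ∑ j, A (Pi.single j 1) i * y j := by
  conv_lhs => rw [pi_eq_sum_univ' y, map_sum]
  rw [Finset.sum_apply]
  refine Finset.sum_congr rfl fun j _ => ?_
  rw [map_smul, Pi.smul_apply, smul_eq_mul, mul_comm]

/-- **Linear maps with real algebraic matrix are `ℚ`-semialgebraic maps.** If every matrix entry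
`A(eⱼ)ᵢ` of an `ℝ`-linear map `A : ℝᵐ → ℝⁿ` is algebraic over `ℚ`, then `A` is a `ℚ`-semialgebraic
map on every `ℚ`-semialgebraic `σ ⊆ ℝᵐ`: each coordinate `∑ⱼ A(eⱼ)ᵢ · yⱼ` is a finite sum of
products of an algebraic constant (a `ℚ`-semialgebraic function, [Kontsevich–Zagier 2001, §1.1])
with a coordinate polynomial. [cite: BochnakCosteRoy1998, Prop. 2.2.6] -/
theorem isSemialgebraicMapOn_continuousLinearMap {m n : ℕ} {σ : Set (Fin m → ℝ)}
    (hσ : IsSemialgebraic ℚ σ) (A : (Fin m → ℝ) →L[ℝ] (Fin n → ℝ))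
    (hA : ∀ j i, IsAlgebraic ℚ (A (Pi.single j 1) i)) : IsSemialgebraicMapOn ℚ σ A := by
  refine IsSemialgebraicMapOn.of_forall hσ fun i => ?_
  have hsum : IsSemialgebraicFunOn ℚ σ (fun y : Fin m → ℝ => ∑ j, A (Pi.single j 1) i * y j) :=
    isSemialgebraicFunOn_finset_sum Finset.univ hσ fun j _ =>
      (IsSemialgebraicFunOn.mul_holds (isSemialgebraicFunOn_const_of_isAlgebraic hσ (hA j i))
        (isSemialgebraicFunOn_aeval hσ (MvPolynomial.X j))).congr fun y _ => by
          simp only [Pi.mul_apply, MvPolynomial.aeval_X]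
  exact hsum.congr fun y _ => (continuousLinearMap_apply_eq_sum A y i).symm

/-! ## The linear rule-(2) certificate -/

/-- **Linear change of variables** (Kontsevich–Zagier rule (2) for an invertible linear map with
algebraic matrix, any dimension): if `A : ℝⁿ → ℝⁿ` is `ℝ`-linear and injective with algebraic
entries `A(eⱼ)ᵢ`, `r'.domain = A '' r.domain`, and `r.integrand x = r'.integrand (A x) · |det A|` on
`r.domain`, then `[r] − [r'] ∈ KZ.changeOfVariablesRel` — witness `Φ = A`, `Φ' ≡ A`.
[cite: KontsevichZagier2001, §1.2 rule (2)] -/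
theorem of_sub_of_mem_changeOfVariablesRel_continuousLinearMap {n : ℕ}
    (A : (Fin n → ℝ) →L[ℝ] (Fin n → ℝ)) (hA : ∀ j i, IsAlgebraic ℚ (A (Pi.single j 1) i))
    (hinj : Function.Injective A) (r r' : IntegralRep n) (himage : r'.domain = A '' r.domain)
    (hint : ∀ x ∈ r.domain, r.integrand x = r'.integrand (A x) * |A.det|) :
    of r - of r' ∈ changeOfVariablesRel :=
  ⟨n, r, r', A, fun _ => A, isSemialgebraicMapOn_continuousLinearMap r.isSemialgebraic_domain A hA,
    fun _ _ => A.hasFDerivAt.hasFDerivWithinAt, hinj.injOn, himage, hint, rfl⟩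

/-! ## Dilating a coordinate slab -/

/-- Dilation of a coordinate condition in `ℝⁿ`: for `s ≠ 0`, `s • {x | x i ∈ S} = {x | x i ∈ s • S}`.
[folklore] -/
theorem smul_setOf_apply_mem {n : ℕ} {s : ℝ} (hs : s ≠ 0) (S : Set ℝ) (i : Fin n) :
    s • {x : Fin n → ℝ | x i ∈ S} = {x : Fin n → ℝ | x i ∈ s • S} := by
  ext x
  rw [Set.mem_smul_set_iff_inv_smul_mem₀ hs, mem_setOf_eq, mem_setOf_eq,
    Set.mem_smul_set_iff_inv_smul_mem₀ hs, Pi.smul_apply]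

/-! ## The registered sub-goal -/

/-- **Scaling by an algebraic factor** (Kontsevich–Zagier rule (2)), registered sub-goal
`dlogA_scale_mem_relations` of crux stmt-KontsevichZagierPeriods-3869, verbatim signature: for real
algebraic `s > 0` and `0 < a`, `[(a,b), c/y] − [(sa, sb), c/y] ∈ relations` — the linear rule-(2)
certificate `of_sub_of_mem_changeOfVariablesRel_continuousLinearMap` at `A = s • id` on `ℝ¹`
(matrix entry `s`, image slab `LinearOrderedField.smul_Ioo`, Jacobian `KZ.det_smul_id_fin`), and the
scalar identity `c/y = (c/(s y))·s` for `y, s > 0`. [cite: KontsevichZagier2001, §1.2 rule (2)] -/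
theorem dlogA_scale_mem_relations {a b c s : ℝ} (hs : IsAlgebraic ℚ s) (L L' : IntegralRep 1)
    (hd : L.domain = {x | x 0 ∈ Set.Ioo a b})
    (hd' : L'.domain = {x | x 0 ∈ Set.Ioo (s * a) (s * b)})
    (hi : EqOn L.integrand (fun x => c / x 0) L.domain)
    (hi' : EqOn L'.integrand (fun x => c / x 0) L'.domain) (ha0 : 0 < a) (hs0 : 0 < s) :
    of L - of L' ∈ relations := by
  set A : (Fin 1 → ℝ) →L[ℝ] (Fin 1 → ℝ) := s • ContinuousLinearMap.id ℝ (Fin 1 → ℝ) with hA_def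
  have hA : (A : (Fin 1 → ℝ) → (Fin 1 → ℝ)) = fun y => s • y := rfl
  have himage : L'.domain = A '' L.domain := by
    rw [hA, hd, hd', Set.image_smul, smul_setOf_apply_mem hs0.ne', LinearOrderedField.smul_Ioo hs0]
  refine changeOfVariablesRel_subset_relations
    (of_sub_of_mem_changeOfVariablesRel_continuousLinearMap A (fun j i => ?_)
      (hA ▸ MulAction.injective₀ hs0.ne') L L' himage fun x hx => ?_)
  · -- the single matrix entry of `s • id` on `ℝ¹` is `s`
    obtain rfl : i = j := Subsingleton.elim i j
    simpa [hA_def] using hs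
  · -- the scalar identity `c / x₀ = (c / (s x₀)) · |det (s • id)|`, `x₀ > 0`, `s > 0`
    have hΦx : A x ∈ L'.domain := himage ▸ mem_image_of_mem _ hx
    have hx0 : (0:ℝ) < x 0 := by
      rw [hd] at hx
      exact lt_trans ha0 hx.1
    have hdet : A.det = s := by rw [hA_def, det_smul_id_fin 1 s, pow_one]
    have hAx : A x 0 = s * x 0 := rfl
    rw [hi hx, hi' hΦx, hdet, abs_of_pos hs0]
    simp only [hAx]
    field_simp

end Summit.KontsevichZagierPeriods.HurwitzMicroSectors.NormalFormPrinciple.DlogAScaleMathlibK1
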